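import Literature.AnabelianGeometry.EtaleTheta.BaseFieldHullConstants
import Literature.AnabelianGeometry.EtaleTheta.SettingModelKrullOpenSubgroups
import Mathlib.FieldTheory.Galois.Infinite
import HarnessLib

/-!
# [EtTh] Lemma 5.8 / Def. 5.4 / §5 p.322 — the ARITHMETIC of the constants dictionary at the base-field-theoretic hull:
# `K ⊆ K_U`, Galois descent `ℚ̄_p^{G_K} = K`, equivariance, `(K^×)^{1/N} ⊆ K_U` on theta-saturated coverings (PROOF-ONLY)

S. Mochizuki, *The étale theta function …*, Publ. RIMS **45** (2009) [MochizukiEtTh2009]: Lemma 5.8 p.331 (PDF p.105) («write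
`(K^×)^{1/N} ⊆ O^×(B_N^birat)` for the subgroup of elements whose `N`-th power lies in the image of the natural inclusion
`K^× ↪ O^×(B_N^birat)` … since `Y` is geometrically connected over `K`, … the set of elements of `O^×(B_N)` … on which `Π^tp_Y` [i.e.,
`G_K`, via the natural surjection `Π^tp_Y ↠ G_K`] acts via … `μ_N(B_N)` … coincide[s] with `(O_K^×)^{1/N}`»), Def. 5.4 p.327 (PDF p.101)
(`B_N` is `(l,N)`-theta-saturated: its base field contains the `N`-th roots of `K`), §5 p.322 (PDF p.96) («geometrically connected
over the field `K = K̈`»), Def. 3.6 (iii) p.304 (PDF p.78) (the constants `K` of the Frobenioid); §1 p.240 (PDF p.14) («`J_N :=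
K_N(a^{1/N})_{a ∈ K_N}` … finite»).  [cite: MochizukiEtTh2009, Lem 5.8 p.331 (PDF p.105); Def 5.4 p.327 (PDF p.101)]

abc-iut cell, layer L2, seat abc-iut-L2-d3 (gen 10); L2-lead ruling R1112 «CONST-DICT CARRIER = C^{bs-fld} HULL OVER THE GENUINE BASE».
PROOF-ONLY (no definition, no `Prop`-valued definition, no instance, no notation, no sorry; nothing landed is edited) over this lineage's
`BaseFieldHullConstants.lean` (p500276: `fixFld`, `eqvFun = B₀(U) = Hom_Γ(Γ/U, ℚ̄_p^×)`, `ev`, `ofFixed`, `pullFun`): the ARITHMETIC CONTENT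
of the laws of abc-iut-L2-t11's `BiratAutAction.ConstantsDictionary` (`ConstantsDictionary.lean`: `constEmb_mem`/`constEmb_read`/
`reaches_K`, `equivariant`, `injective`, `roots_of_K`, `mu_compat`, and the Galois descent inside `hgc`) READ AT THE HULL'S CONSTANTS, for
ANY topological group `Γ`, ANY `a : Γ → G_{ℚ_p}` and ANY finite `K ⊆ ℚ̄_p` with `a(Γ) ≤ G_K`:
* §1 `le_fixFld_of_forall_mem` — **`K ⊆ K_U`** for every open `U` (`constEmb_mem` / `constEmb_read` / `reaches_K`: the constants `K^×`
  ARE constants of every covering, read identically);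
* §2 `mem_of_forall_smul_eq` / `ev_mem_of_forall_smul_eq` — **GALOIS DESCENT `ℚ̄_p^{a(W)} = K` whenever `a(W) ⊇ G_K`** (print: «`Π^tp_Y`
  [i.e., `G_K`, via the natural surjection `Π^tp_Y ↠ G_K`]», «geometrically connected over `K`»; Mathlib `InfiniteGalois.fixedField_fixingSubgroup`):
  a constant of `Γ/U` on which `W` acts trivially lies in `K` — the arithmetic half of `hgc` / `InvariantUnitsEqConstants`;
* §3 `ev_pullFun` (p500276) is the law `equivariant`; `ev_injective` (p500276) the law `injective` — recorded as the dictionary reads them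
  (`smul_ev_mem_range_ev`: the Galois translate of a constant of `Γ/U` by `a(g)`, `g ∈ N_Γ(U)`, is again a constant of `Γ/U`);
* §4 **`roots_of_K` ON THETA-SATURATED COVERINGS** — for `U` with `a(U) ≤ G_{J}`, `J := K((K)^{1/N}) = adjoin(K ∪ {x | x^N ∈ K})`
  (abc-iut-L2-t11's field, FINITE over `ℚ_p` by `finiteDimensional_adjoin_pow_mem`, so `G_J` is OPEN): every `y ∈ K` has an `N`-th root in
  `K_U` (`exists_mem_fixFld_pow_eq`), in particular `μ_N(ℚ̄_p) ⊆ K_U` (`mem_fixFld_of_pow_eq_one`, the law `mu_compat`'s carrier); and such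
  `U` EXIST inside every open `W` when `a` is continuous (`exists_open_le_map_le_fixingSubgroup`: `U := W ∩ a⁻¹(G_J)`).
HONEST FRAMING: classical Galois/Kummer theory of `ℚ̄_p/ℚ_p`; these are the dictionary's laws at the level of the hull's `B₀`; plugging them
into `ConstantsDictionary` itself awaits the §5 junction data (`N`-th root objects `B_N`) at the hull — not done here.  Nothing of [EtTh] is
asserted; nothing here bears on [IUTchIII] Cor. 3.12; no side taken; typed ≠ proved elsewhere.
-/

noncomputable section

namespace Literature.AnabelianGeometry.EtaleTheta

open Literature.AnabelianGeometry.SemiGraphs Literature.AlgebraicGeometry.Frobenioids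

namespace BsFldHull

variable (p : ℕ) [Fact p.Prime] {Γ : Type} [Group Γ] [TopologicalSpace Γ] (a : Γ →* GQp p)
  (K : IntermediateField ℚ_[p] (PadicAlgCl p))

/-! ## §1 `K ⊆ K_U` -/

/-- **`K ⊆ K_U`** for every open `U ⊆ Γ` when `a(Γ) ≤ G_K` (the constants `K` of the Frobenioid are constants of every covering: Def. 3.6
(iii); the law `constEmb_mem`). [cite: MochizukiEtTh2009, Def 3.6 (iii) p.304 (PDF p.78)] -/
theorem le_fixFld_of_forall_mem (hK : ∀ g : Γ, a g ∈ K.fixingSubgroup) (U : OpenSubgroup Γ) : K ≤ fixFld p a U := by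
  intro x hx
  rw [mem_fixFld_iff]
  intro u _
  exact (IntermediateField.mem_fixingSubgroup_iff _ _).mp (hK u) x hx

/-- Hence an element of `K^×` is the value of a constant function of `Γ/U` (`ofFixed`; the laws `constEmb_read` / `reaches_K`: the reading
of `K^×` is onto `K^×`). [cite: MochizukiEtTh2009, Def 3.6 (iii) p.304 (PDF p.78)] -/
theorem exists_ev_eq_of_mem (hK : ∀ g : Γ, a g ∈ K.fixingSubgroup) (U : CosetCat Γ) (z : (PadicAlgCl p)ˣ) (hz : (z : PadicAlgCl p) ∈ K) :
    ∃ b : eqvFun p a U, ev p a U b = z :=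
  ⟨ofFixed p a U z (le_fixFld_of_forall_mem p a K hK U.sg hz), ev_ofFixed p a U z _⟩

/-! ## §2 Galois descent: invariants are constants -/

omit [TopologicalSpace Γ] in
/-- **Galois descent `ℚ̄_p^{a(W)} = K`**: if `a(W) ⊇ G_K` («`Π^tp_Y` [i.e., `G_K`, via the natural surjection `Π^tp_Y ↠ G_K`]»; `Y` geometrically
connected over `K`), an element of `ℚ̄_p` fixed by `a(w)` for all `w ∈ W` lies in `K` (Mathlib `InfiniteGalois.fixedField_fixingSubgroup`).
[cite: MochizukiEtTh2009, Lem 5.8 p.331 (PDF p.105)] -/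
theorem mem_of_forall_smul_eq {W : Subgroup Γ} (hW : K.fixingSubgroup ≤ W.map a) {x : PadicAlgCl p} (hx : ∀ w ∈ W, a w x = x) : x ∈ K := by
  haveI : IsGalois ℚ_[p] (PadicAlgCl p) := {}
  have hmem : x ∈ IntermediateField.fixedField K.fixingSubgroup := by
    rintro ⟨σ, hσ⟩
    obtain ⟨w, hw, rfl⟩ := Subgroup.mem_map.mp (hW hσ)
    exact hx w hw
  rwa [InfiniteGalois.fixedField_fixingSubgroup] at hmem

/-- **A constant of `Γ/U` on which `W` acts trivially is a constant from `K`** (the arithmetic half of Lemma 5.8's `hgc` /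
`InvariantUnitsEqConstants`: «the set of elements … on which `Π^tp_Y` acts [trivially] … is `O_K^×`»), for `a(W) ⊇ G_K`.
[cite: MochizukiEtTh2009, Lem 5.8 p.331 (PDF p.105)] -/
theorem ev_mem_of_forall_smul_eq {W : Subgroup Γ} (hW : K.fixingSubgroup ≤ W.map a) {U : CosetCat Γ} (b : eqvFun p a U)
    (hb : ∀ w ∈ W, a w • ev p a U b = ev p a U b) : ((ev p a U b : (PadicAlgCl p)ˣ) : PadicAlgCl p) ∈ K :=
  mem_of_forall_smul_eq p a K hW fun w hw => congrArg (fun u : (PadicAlgCl p)ˣ => (u : PadicAlgCl p)) (hb w hw)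

omit [TopologicalSpace Γ] in
/-- Conversely constants from `K` are fixed by all of `a(Γ)`. [cite: MochizukiEtTh2009, Lem 5.8 p.331 (PDF p.105)] -/
theorem smul_eq_of_mem (hK : ∀ g : Γ, a g ∈ K.fixingSubgroup) {x : (PadicAlgCl p)ˣ} (hx : (x : PadicAlgCl p) ∈ K) (g : Γ) : a g • x = x :=
  Units.ext ((IntermediateField.mem_fixingSubgroup_iff _ _).mp (hK g) _ hx)

/-- **`(K_U)^{a(W)} = K`** at the level of `B₀(U)`: for `a(Γ) ≤ G_K ≤ a(W)`, a constant of `Γ/U` is `W`-invariant IFF it comes from `K`.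
[cite: MochizukiEtTh2009, Lem 5.8 p.331 (PDF p.105)] -/
theorem forall_smul_ev_eq_iff (hK : ∀ g : Γ, a g ∈ K.fixingSubgroup) {W : Subgroup Γ} (hW : K.fixingSubgroup ≤ W.map a)
    {U : CosetCat Γ} (b : eqvFun p a U) :
    (∀ w ∈ W, a w • ev p a U b = ev p a U b) ↔ ((ev p a U b : (PadicAlgCl p)ˣ) : PadicAlgCl p) ∈ K :=
  ⟨ev_mem_of_forall_smul_eq p a K hW b, fun h w _ => smul_eq_of_mem p a K hK h w⟩

/-! ## §3 Equivariance and the action of `N_Γ(U)` on the constants of `Γ/U` -/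

/-- **The Galois translate `a(g)·x` of a constant `x ∈ K_U` of `Γ/U` by `g ∈ N_Γ(U)` is again a constant of `Γ/U`** (`K_U` is stable under
`a(N_Γ(U))`: the deck transformations act on the constants through `a`; the law `act_mem`). [cite: MochizukiEtTh2009, Lem 5.8 p.331 (PDF p.105)] -/
theorem smul_mem_fixFld_of_mem_normalizer (U : OpenSubgroup Γ) {g : Γ} (hg : g ∈ Subgroup.normalizer ((U : Subgroup Γ) : Set Γ))
    {x : PadicAlgCl p} (hx : x ∈ fixFld p a U) : a g x ∈ fixFld p a U := by
  rw [mem_fixFld_iff] at hx ⊢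
  intro u hu
  have hu' : g⁻¹ * u * g ∈ (U : Subgroup Γ) := by
    have := (Subgroup.mem_normalizer_iff.mp hg) (g⁻¹ * u * g)
    rw [show g * (g⁻¹ * u * g) * g⁻¹ = u by group] at this
    exact this.mpr hu
  have h := hx _ hu'
  rw [map_mul, map_mul, map_inv, AlgEquiv.mul_apply, AlgEquiv.mul_apply] at h
  have h2 := congrArg (a g) h
  rwa [← AlgEquiv.mul_apply, mul_inv_cancel, AlgEquiv.one_apply] at h2

/-- The law `equivariant` at the hull, in the dictionary's shape: the value of the pulled-back constant is the Galois translate by `a`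
(this lineage's `ev_pullFun`, p500276). [cite: MochizukiEtTh2009, Lem 5.8 p.331 (PDF p.105)] -/
theorem equivariant_law {V U : CosetCat Γ} (f : V ⟶ U) (b : eqvFun p a U) {g : Γ} (hg : CosetCat.pt f = (g : U.carrier)) :
    ev p a V (pullFun p a f b) = a g • ev p a U b :=
  ev_pullFun p a f b hg

/-! ## §4 `N`-th roots of `K` on theta-saturated coverings -/

section Roots

variable (N : ℕ+)

/-- `J := K(K^{1/N})`, abc-iut-L2-t11's `adjoin ℚ_p (K ∪ {x | x^N ∈ K})` (print's `J_N`-type field). [cite: MochizukiEtTh2009, §1 p.240 (PDF p.14)] -/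
theorem pow_mem_adjoin_of_pow_mem {x : PadicAlgCl p} (hx : x ^ (N : ℕ) ∈ K) :
    x ∈ IntermediateField.adjoin ℚ_[p] ((K : Set (PadicAlgCl p)) ∪ {x | x ^ (N : ℕ) ∈ K}) :=
  IntermediateField.subset_adjoin ℚ_[p] _ (Or.inr hx)

/-- **Every element of `K` has an `N`-th root in `K_U` when `a(U) ≤ G_J`**, `J = K(K^{1/N})` (Def. 5.4: `B_N` theta-saturated ⇒ its base
field contains `K(k^{1/N})`; Lemma 5.8 «`(K^×)^{1/N} ⊆ O^×(B_N^birat)`»; the law `roots_of_K`). [cite: MochizukiEtTh2009, Def 5.4 p.327 (PDF p.101)] -/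
theorem exists_mem_fixFld_pow_eq (U : OpenSubgroup Γ)
    (hU : (U.toSubgroup.map a : Subgroup (GQp p)) ≤ (IntermediateField.adjoin ℚ_[p] ((K : Set (PadicAlgCl p)) ∪ {x | x ^ (N : ℕ) ∈ K})).fixingSubgroup)
    (y : PadicAlgCl p) (hy : y ∈ K) : ∃ x : PadicAlgCl p, x ∈ fixFld p a U ∧ x ^ (N : ℕ) = y := by
  obtain ⟨x, hx⟩ := IsAlgClosed.exists_pow_nat_eq y N.pos
  refine ⟨x, ?_, hx⟩
  rw [mem_fixFld_iff]
  intro u hu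
  have hmem : a u ∈ (IntermediateField.adjoin ℚ_[p] ((K : Set (PadicAlgCl p)) ∪ {x | x ^ (N : ℕ) ∈ K})).fixingSubgroup :=
    hU (Subgroup.mem_map_of_mem a hu)
  exact (IntermediateField.mem_fixingSubgroup_iff _ _).mp hmem x (pow_mem_adjoin_of_pow_mem p K N (hx ▸ hy))

/-- In particular **`μ_N(ℚ̄_p) ⊆ K_U`** on such coverings (the cyclotomes of `B_N` read in `ℚ̄_p`; the law `mu_compat`'s carrier).
[cite: MochizukiEtTh2009, Lem 5.8 p.331 (PDF p.105)] -/
theorem mem_fixFld_of_pow_eq_one (U : OpenSubgroup Γ)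
    (hU : (U.toSubgroup.map a : Subgroup (GQp p)) ≤ (IntermediateField.adjoin ℚ_[p] ((K : Set (PadicAlgCl p)) ∪ {x | x ^ (N : ℕ) ∈ K})).fixingSubgroup)
    {ζ : PadicAlgCl p} (hζ : ζ ^ (N : ℕ) = 1) : ζ ∈ fixFld p a U := by
  rw [mem_fixFld_iff]
  intro u hu
  have hmem : a u ∈ (IntermediateField.adjoin ℚ_[p] ((K : Set (PadicAlgCl p)) ∪ {x | x ^ (N : ℕ) ∈ K})).fixingSubgroup :=
    hU (Subgroup.mem_map_of_mem a hu)
  exact (IntermediateField.mem_fixingSubgroup_iff _ _).mp hmem ζ (pow_mem_adjoin_of_pow_mem p K N (hζ ▸ one_mem K))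

/-- Hence the `N`-th root, as a constant FUNCTION of `Γ/U` (`ofFixed`), has `N`-th power the constant `y` (the law `roots_of_K` in the
dictionary's shape: `(ν' f)^N = y`). [cite: MochizukiEtTh2009, Lem 5.8 p.331 (PDF p.105)] -/
theorem exists_ev_pow_eq (U : CosetCat Γ)
    (hU : (U.sg.toSubgroup.map a : Subgroup (GQp p)) ≤ (IntermediateField.adjoin ℚ_[p] ((K : Set (PadicAlgCl p)) ∪ {x | x ^ (N : ℕ) ∈ K})).fixingSubgroup)
    (y : (PadicAlgCl p)ˣ) (hy : (y : PadicAlgCl p) ∈ K) :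
    ∃ b : eqvFun p a U, ((ev p a U b : (PadicAlgCl p)ˣ) : PadicAlgCl p) ^ (N : ℕ) = y := by
  obtain ⟨x, hx, hxy⟩ := exists_mem_fixFld_pow_eq p a K N U.sg hU y hy
  have hx0 : x ≠ 0 := by
    intro h
    rw [h, zero_pow N.ne_zero] at hxy
    exact y.ne_zero hxy.symm
  exact ⟨ofFixed p a U (Units.mk0 x hx0) hx, by rw [ev_ofFixed, Units.val_mk0, hxy]⟩

/-- **Theta-saturated coverings EXIST below every covering**: for `a` continuous and `K` finite over `ℚ_p`, every open `W ⊆ Γ` contains an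
open `U` with `a(U) ≤ G_J`, `J = K(K^{1/N})` — namely `U := W ∩ a⁻¹(G_J)`, open since `J/ℚ_p` is FINITE (abc-iut-L2-t11's
`finiteDimensional_adjoin_pow_mem`: «`K^×/(K^×)^N` … is finite», §1 p.240) so `G_J` is open (Krull).  [cite: MochizukiEtTh2009, §1 p.240 (PDF p.14); Def 5.4 p.327 (PDF p.101)] -/
theorem exists_open_le_map_le_fixingSubgroup [FiniteDimensional ℚ_[p] K] (hcont : Continuous a) (W : OpenSubgroup Γ) :
    ∃ U : OpenSubgroup Γ, U ≤ W ∧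
      (U.toSubgroup.map a : Subgroup (GQp p)) ≤ (IntermediateField.adjoin ℚ_[p] ((K : Set (PadicAlgCl p)) ∪ {x | x ^ (N : ℕ) ∈ K})).fixingSubgroup := by
  haveI := finiteDimensional_adjoin_pow_mem K N
  set J := IntermediateField.adjoin ℚ_[p] ((K : Set (PadicAlgCl p)) ∪ {x | x ^ (N : ℕ) ∈ K}) with hJ
  have hopen : IsOpen ((J.fixingSubgroup : Subgroup (GQp p)) : Set (GQp p)) := IntermediateField.fixingSubgroup_isOpen J
  let GJ : OpenSubgroup (GQp p) := ⟨J.fixingSubgroup, hopen⟩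
  refine ⟨W ⊓ GJ.comap a hcont, inf_le_left, ?_⟩
  rintro _ ⟨u, hu, rfl⟩
  exact (OpenSubgroup.mem_comap.mp (((OpenSubgroup.mem_inf).mp hu).2))

end Roots

end BsFldHull

end Literature.AnabelianGeometry.EtaleTheta

end
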